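import HarnessLib
import Summits.SmoothPoincare4.SmoothPoincare4.Theses.VerlindeRLinks
import Summits.SmoothPoincare4.SmoothPoincare4.Theorems.VerlindeRLinksVrlComponentsHBallSliceStubFramedTubes
import Summits.SmoothPoincare4.SmoothPoincare4.Theorems.VerlindeRLinksVrlComponentsHBallSliceStubBoundarySurgery
import Summits.SmoothPoincare4.SmoothPoincare4.Theorems.VerlindeRLinksVrlComponentsHBallSliceStubAttachingMapOfTube
import Summits.SmoothPoincare4.SmoothPoincare4.Theorems.VerlindeRLinksVrlComponentsHBallSliceStubCoreSliceDisc
import Literature.Topology.FourManifolds.RLinkSphere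
import Literature.Topology.FourManifolds.RLinkSphereHomotopySphereProofs
import Literature.Topology.FourManifolds.GluingProofs
import Literature.Topology.FourManifolds.Cobordism
import Literature.Topology.FourManifolds.LickorishWallace
import Literature.Topology.FourManifolds.SphereTwoProdCircleSumUniqueness
import Literature.Topology.FourManifolds.FreeFundamentalGroupThreeManifoldHempel
import Literature.Topology.FourManifolds.LinkSurgeryFramedUniqueness
import Literature.Topology.FourManifolds.PropertyRTraceBridgeOfPropertyRHolds
import Literature.Topology.FourManifolds.HandleAttachingMapsExistence
import Literature.Topology.FourManifolds.OneHandlebodyBoundarySum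
import Literature.Topology.FourManifolds.OneHandlebodyBoundarySumProofs

/-!
# Line `kirby-lemma21` — the crux `VerlindeRLinks.VrlComponentsHBallSlice` (stmt-SmoothPoincare4-15874)
# REDUCED to Kirby's sentence `∂(♮ⁿ S¹ × B³) = #ⁿ(S² × S¹)` / to the `S⁰`-surgery lemma

Crux (route `route-SmoothPoincare4-VerlindeRLinks`, item #9, Gompf–Scharlemann–Thompson 2010 Prop. 2.3
(Hillman), componentwise): every component `L.component i` of an R-link `L ⊂ S³` (`n` components, the
integral surgery `Y` on `L` is `#ⁿ(S² × S¹)` in the sense `IsSphereTwoProdCircleSum n Y`) is slice in a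
homotopy `4`-ball (`Knot.IsHomotopyBallSlice`).

This file is the SORRY-FREE COMPOSITION of the registered skeleton `Cruxes/VrlComponentsHBallSlice/Lines/
kirby_lemma21.lean` (lead's reshape, 5 stubs) run on the four LANDED stubs

* `stub_exists_disjoint_framedTubes` (`…StubFramedTubes.lean`),
* `stub_attachingMap_of_tube` (`…StubAttachingMapOfTube.lean`),
* `stub_isSurgery_boundary_of_isMultiAttachment` (`…StubBoundarySurgery.lean`, Kirby's Lemma 2.1 for links),
* `stub_core_isSliceDiscIn_of_isMultiAttachment` (`…StubCoreSliceDisc.lean`),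

with the fifth, `stub_oneHandlebody_boundary` — VERBATIM the Literature named fact
`exists_oneHandlebody_four_boundary_isSphereTwoProdCircleSum` (`OneHandlebodyBoundarySum.lean`, Kirby 1989,
Ch. I §2, p. 8: some compact connected orientable `(1,n)`-handlebody has a boundary datum `#ⁿ(S² × S¹)`) —
kept as a HYPOTHESIS.  Three registered helper stubs record the reduction at three depths:

* `helper_crux_of_kirbySentence` — the crux from Kirby's sentence;
* `helper_crux_of_step` — the crux from the one-handle step
  `isConnectedSum_boundary_of_isHandleAttachment_one` (`∂(V' ∪ h¹) = ∂V' # (S² × S¹)`; Kirby's sentence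
  is PROVED from it in `OneHandlebodyBoundarySum.lean`, `…_of_step`);
* `helper_crux_of_zeroSphereSurgery` — the crux from piece (2) of the roadmap alone: *`0`-surgery along a
  framed `S⁰` in a connected `3`-manifold with orientable result is `· # (S² × S¹)`* (the step is PROVED
  from it in `OneHandlebodyBoundarySumProofs.lean`, using the LANDED piece (1)
  `IsHandleAttachment.exists_framedSphereFamily_isSurgery_boundary`).

THE LINE (unchanged).  Close the trace `P = D⁴ ∪_L (2-handles)` — Kosinski's simultaneous attachment
(`HandleAttachingMap.IsMultiAttachment`, existence discharged) along the RADIAL attaching maps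
`gᵢ y = (1 - depth(y)/4) · νᵢ (angle y, fibre y)` of disjoint framed tubes — with a `(1,n)`-handlebody `V`
(`∂P` is the surgery on `L` by stub 2, `≅ Y ≅ #ⁿ(S² × S¹) ≅ ∂V` by uniqueness of link surgery and of
`#ⁿ(S² × S¹)`) to the R-link sphere `X = P ∪_φ V`, a homotopy `4`-sphere
(`IsRLinkSphere.nonempty_homotopyEquiv_sphere_holds`, PROVED), and read the core of the `i`-th handle in
`X` (stub 4): an `IsSliceDiscIn` datum, whence `Knot.IsSliceDiscIn.isHomotopyBallSlice`.

## References

* R. C. Kirby, *The Topology of 4-Manifolds*, LNM 1374 (1989), Ch. I §2 (p. 8), Lemma 2.1, §5. [Kirby1989]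
* R. E. Gompf, M. Scharlemann, A. Thompson, Geom. Topol. 14 (2010) 2305–2347 (arXiv:1103.1601),
  Prop. 2.3 and §9. [GompfScharlemannThompson2010]
* A. A. Kosinski, *Differential Manifolds* (1993), III §4, VI §6, §9. [Kosinski1993]
* R. E. Gompf, A. I. Stipsicz, *4-Manifolds and Kirby Calculus* (1999), §5.3, Prop. 5.1.2. [GompfStipsicz1999]
-/

-- `Summit.<Summit>.<Problem>`: single-conjunct summit, the duplicate component is mandated (CONVENTIONS §2).
set_option linter.dupNamespace false

noncomputable section

namespace Summit.SmoothPoincare4.SmoothPoincare4.Theorems.VrlComponentsHBallSlice.KirbyLemma21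

open scoped Manifold ContDiff Topology
open Set Function
open Literature.Topology.FourManifolds
open Summit.SmoothPoincare4.SmoothPoincare4.Theses.VerlindeRLinks

/-! The five stubs are the landed theorems `stub_exists_disjoint_framedTubes`, `stub_attachingMap_of_tube`,
`stub_isSurgery_boundary_of_isMultiAttachment`, `stub_oneHandlebody_boundary`,
`stub_core_isSliceDiscIn_of_isMultiAttachment` of this namespace (files `…Stub*.lean`, imported above). -/

/-! ## Sorry-free composition, 0: bookkeeping of the radial attaching maps -/

section Radial

variable {n : ℕ} {L : FramedLink (Fin n)}
  {g : Fin n → HandleAttachingMap 3 2 (Metric.closedBall (0 : EuclideanSpace ℝ (Fin 4)) 1)}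
  {ν : ∀ i, Knot.TubularNbhd ⇑(L.component i)}

/-- **Boundary values of the radial attaching maps**: at depth `0` (i.e. on `T ∩ ∂D⁴`) the radial
formula `gᵢ y = (1 - depth(y)/4) · νᵢ (angle y, fibre y)` reads `gᵢ y = incl (νᵢ (angle y, fibre y))`
— the clause `carvedEmbed_handle` of `DottedCircleDiagram.Realization` with carved ball `𝔻 4`.
[Kosinski1993, VI §6] -/
theorem boundaryValues_of_radial
    (hg : ∀ (i : Fin n) (y : ↥(handleTube 3 2)),
      (((g i).toFun y : Metric.closedBall (0 : EuclideanSpace ℝ (Fin 4)) 1) : EuclideanSpace ℝ (Fin 4)) =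
        (1 - tubeDepth y / 4) •
          ((ν i (tubeAngle y, tubeFibre y) : Metric.sphere (0 : EuclideanSpace ℝ (Fin 4)) 1) :
            EuclideanSpace ℝ (Fin 4))) :
    ∀ (i : Fin n) (y : ↥(handleTube 3 2)), tubeDepth y = 0 →
      (g i).toFun y = (closedBallBoundaryData 3).incl (ν i (tubeAngle y, tubeFibre y)) := by
  intro i y hy
  apply Subtype.ext
  rw [hg i y, hy, coe_incl_three]
  simp

/-- **The radial attaching maps of disjoint tubes have disjoint ranges**: `gᵢ y = gⱼ y'` forces equal
`D⁴`-radii `1 - depth/4 ∈ (3/4, 1]`, hence equal directions `νᵢ (…) = νⱼ (…)`, impossible for `i ≠ j`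
when the tubes have disjoint ranges. [Kosinski1993, VI §6] -/
theorem pairwise_disjoint_range_of_radial
    (hν : Pairwise fun i j => Disjoint (range ⇑(ν i)) (range ⇑(ν j)))
    (hg : ∀ (i : Fin n) (y : ↥(handleTube 3 2)),
      (((g i).toFun y : Metric.closedBall (0 : EuclideanSpace ℝ (Fin 4)) 1) : EuclideanSpace ℝ (Fin 4)) =
        (1 - tubeDepth y / 4) •
          ((ν i (tubeAngle y, tubeFibre y) : Metric.sphere (0 : EuclideanSpace ℝ (Fin 4)) 1) :
            EuclideanSpace ℝ (Fin 4))) :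
    Pairwise fun i j => Disjoint (range (g i).toFun) (range (g j).toFun) := by
  intro i j hij
  refine Set.disjoint_left.2 ?_
  rintro _ ⟨y, rfl⟩ ⟨y', hy'⟩
  -- equal points of `D⁴` have equal radii and equal directions
  have hv : (1 - tubeDepth y' / 4) •
      ((ν j (tubeAngle y', tubeFibre y') : Metric.sphere (0 : EuclideanSpace ℝ (Fin 4)) 1) :
        EuclideanSpace ℝ (Fin 4)) =
      (1 - tubeDepth y / 4) •
      ((ν i (tubeAngle y, tubeFibre y) : Metric.sphere (0 : EuclideanSpace ℝ (Fin 4)) 1) :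
        EuclideanSpace ℝ (Fin 4)) := by
    rw [← hg j y', ← hg i y, hy']
  have hc : 0 < 1 - tubeDepth y / 4 := by
    have := tubeDepth_lt_one y; linarith
  have hc' : 0 < 1 - tubeDepth y' / 4 := by
    have := tubeDepth_lt_one y'; linarith
  have hn : 1 - tubeDepth y' / 4 = 1 - tubeDepth y / 4 := by
    have := congrArg norm hv
    rwa [norm_smul, norm_smul, Real.norm_of_nonneg hc.le, Real.norm_of_nonneg hc'.le,
      norm_eq_of_mem_sphere, norm_eq_of_mem_sphere, mul_one, mul_one] at this
  rw [hn] at hv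
  have hdir : (ν j (tubeAngle y', tubeFibre y') : Metric.sphere (0 : EuclideanSpace ℝ (Fin 4)) 1) =
      ν i (tubeAngle y, tubeFibre y) :=
    Subtype.ext (smul_right_injective _ hc.ne' hv)
  have hmem : (ν i (tubeAngle y, tubeFibre y) : Metric.sphere (0 : EuclideanSpace ℝ (Fin 4)) 1) ∈
      range ⇑(ν j) := ⟨_, hdir⟩
  exact Set.disjoint_left.1 (hν hij) (mem_range_self _) hmem

/-- **`D⁴` with `2`-handles attached along the radial attaching maps of framed tubes of the components
of `L` is a trace of `L`**: the realization record of `DottedCircleDiagram.ofFramedLink L` with carved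
ball `𝔻 4` itself (`carvedEmbed = Subtype.val`, no dual handles), exactly as in the `n = 1` theorem
`HandleAttachingMap.exists_isTrace_of_isMultiAttachment`. [Kirby1989, Ch. I §2 (p. 8)]
[Kosinski1993, VI §6] -/
theorem isTrace_of_isMultiAttachment (hfr : ∀ i, (ν i).HasFraming (L.framing i))
    (hbd : ∀ (i : Fin n) (y : ↥(handleTube 3 2)), tubeDepth y = 0 →
      (g i).toFun y = (closedBallBoundaryData 3).incl (ν i (tubeAngle y, tubeFibre y)))
    {P : Type} [TopologicalSpace P] [ChartedSpace (EuclideanHalfSpace 4) P]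
    (hP : HandleAttachingMap.IsMultiAttachment g (𝓡∂ 4) P) : L.IsTrace P := by
  obtain ⟨hdisj, jA, jB, hjA, hjAo, hjB, hcov, hglue, hdisjB⟩ := hP
  exact ⟨{
    carved := Metric.closedBall (0 : EuclideanSpace ℝ (Fin 4)) 1
    dual := fun i => i.elim0
    disjoint_dual := fun i => i.elim0
    carvedEmbed := Subtype.val
    discHandle := fun i => i.elim0
    isSmoothEmbedding_carvedEmbed := Manifold.IsSmoothEmbedding.of_opens _
    isOpen_range_carvedEmbed := by
      rw [Subtype.range_coe_subtype]
      exact (HandleAttachingMap.coresComplement _).isOpen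
    isSmoothEmbedding_discHandle := fun i => i.elim0
    isOpen_range_discHandle := fun i => i.elim0
    cover_closedBall := eq_univ_of_forall fun x => Or.inl ⟨⟨x, by simp⟩, rfl⟩
    carvedEmbed_eq_discHandle_iff := fun i => i.elim0
    disjoint_discHandle := fun i => i.elim0
    discHandle_beltDiscPt := fun i => i.elim0
    handle := g
    disjoint_handle := hdisj
    handle_mem := fun j y => (HandleAttachingMap.mem_coresComplement _).2 fun i => i.elim0
    tube := ν
    hasFraming_tube := hfr
    carvedEmbed_handle := fun j y hy => hbd j y hy
    glued := jA
    handlePiece := jB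
    isSmoothEmbedding_glued := hjA
    isOpen_range_glued := hjAo
    isSmoothEmbedding_handlePiece := fun j => (hjB j).1
    isOpen_range_handlePiece := fun j => (hjB j).2
    cover := hcov
    glued_eq_handlePiece_iff := hglue
    disjoint_handlePiece := hdisjB }⟩

end Radial

/-! ## Sorry-free composition, I: the five stubs give the crux -/

/-- **Composition with the five stub signatures as explicit hypotheses** (GST 2010, proof of Prop. 2.3
closed up as in §9): framed tubes with disjoint ranges (stub 1a) and their radial attaching maps
(stub 1b, one per component; boundary values and disjoint ranges by `boundaryValues_of_radial`,
`pairwise_disjoint_range_of_radial`); attach the handles (`HandleAttachingMap.exists_isMultiAttachment_holds`,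
discharged): a compact trace `P` (`isTrace_of_isMultiAttachment`) whose canonical boundary `∂P`
(`BoundaryManifold.boundaryData`) is a surgery on `L` (stub 2), hence `≅ Y` (uniqueness of link surgery,
`FramedLink.IsSurgery.nonempty_diffeomorph_holds`), hence `#ⁿ(S² × S¹)`; a `(1,n)`-handlebody `V` with
`∂V ≅ #ⁿ(S² × S¹) ≅ ∂P` (stub 3, `IsSphereTwoProdCircleSum.nonempty_diffeomorph`); glue `X = P ∪_φ V`
(`exists_isBoundaryGluing_holds`): an R-link sphere (`IsRLinkSphere.mk`), compact and `≃ₕ S⁴`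
(`IsRLinkSphere.nonempty_homotopyEquiv_sphere_holds`, PROVED); the core of the `i`-th handle read
through the gluing embedding `jP : P ↪ X` (stub 4) is an `IsSliceDiscIn` datum, whence
`Knot.IsSliceDiscIn.isHomotopyBallSlice`. [GompfScharlemannThompson2010, Prop. 2.3 and §9] -/
theorem isHomotopyBallSlice_of_stubs
    (hT : ∀ (n : ℕ) (L : FramedLink (Fin n)),
      ∃ ν : ∀ i, Knot.TubularNbhd ⇑(L.component i),
        (∀ i, (ν i).HasFraming (L.framing i)) ∧
        Pairwise fun i j => Disjoint (range ⇑(ν i)) (range ⇑(ν j)))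
    (hA : ∀ (K : Knot) (ν : Knot.TubularNbhd ⇑K),
      ∃ g : HandleAttachingMap 3 2 (Metric.closedBall (0 : EuclideanSpace ℝ (Fin 4)) 1),
        ∀ y : ↥(handleTube 3 2),
          ((g.toFun y : Metric.closedBall (0 : EuclideanSpace ℝ (Fin 4)) 1) : EuclideanSpace ℝ (Fin 4)) =
            (1 - tubeDepth y / 4) •
              ((ν (tubeAngle y, tubeFibre y) : Metric.sphere (0 : EuclideanSpace ℝ (Fin 4)) 1) :
                EuclideanSpace ℝ (Fin 4)))
    (hB : ∀ (n : ℕ) (L : FramedLink (Fin n))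
      (g : Fin n → HandleAttachingMap 3 2 (Metric.closedBall (0 : EuclideanSpace ℝ (Fin 4)) 1))
      (ν : ∀ i, Knot.TubularNbhd ⇑(L.component i)),
      (∀ i, (ν i).HasFraming (L.framing i)) →
      (Pairwise fun i j => Disjoint (range ⇑(ν i)) (range ⇑(ν j))) →
      (∀ (i : Fin n) (y : ↥(handleTube 3 2)), tubeDepth y = 0 →
        (g i).toFun y = (closedBallBoundaryData 3).incl (ν i (tubeAngle y, tubeFibre y))) →
      ∀ (P : Type) [TopologicalSpace P] [ChartedSpace (EuclideanHalfSpace 4) P]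
        [IsManifold (𝓡∂ 4) ((⊤ : ℕ∞) : WithTop ℕ∞) P],
        HandleAttachingMap.IsMultiAttachment g (𝓡∂ 4) P →
          ∀ bP : BoundaryData (𝓡∂ 4) P (𝓡 3), L.IsSurgery (𝓡 3) bP.carrier)
    (hV : ∀ n : ℕ, ∃ (V : Type) (_ : TopologicalSpace V) (_ : T2Space V) (_ : SecondCountableTopology V)
      (_ : ChartedSpace (EuclideanHalfSpace 4) V) (_ : IsManifold (𝓡∂ 4) ((⊤ : ℕ∞) : WithTop ℕ∞) V)
      (_ : CompactSpace V) (_ : ConnectedSpace V) (bV : BoundaryData (𝓡∂ 4) V (𝓡 3)),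
      HasHandleDecomposition 3 V (handleCount 1 n) ∧ IsOrientable (𝓡∂ 4) V ∧
        IsSphereTwoProdCircleSum n bV.carrier)
    (hC : ∀ (n : ℕ) (L : FramedLink (Fin n))
      (g : Fin n → HandleAttachingMap 3 2 (Metric.closedBall (0 : EuclideanSpace ℝ (Fin 4)) 1))
      (ν : ∀ i, Knot.TubularNbhd ⇑(L.component i)),
      (∀ (i : Fin n) (y : ↥(handleTube 3 2)),
        (((g i).toFun y : Metric.closedBall (0 : EuclideanSpace ℝ (Fin 4)) 1) : EuclideanSpace ℝ (Fin 4)) =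
          (1 - tubeDepth y / 4) •
            ((ν i (tubeAngle y, tubeFibre y) : Metric.sphere (0 : EuclideanSpace ℝ (Fin 4)) 1) :
              EuclideanSpace ℝ (Fin 4))) →
      ∀ (P : Type) [TopologicalSpace P] [T2Space P] [ChartedSpace (EuclideanHalfSpace 4) P]
        [IsManifold (𝓡∂ 4) ((⊤ : ℕ∞) : WithTop ℕ∞) P],
        HandleAttachingMap.IsMultiAttachment g (𝓡∂ 4) P →
        ∀ (X : Type) [TopologicalSpace X] [T2Space X] [ChartedSpace (EuclideanSpace ℝ (Fin 4)) X]
          [IsManifold (𝓡 4) ((⊤ : ℕ∞) : WithTop ℕ∞) X] (j : P → X),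
          Manifold.IsSmoothEmbedding (𝓡∂ 4) (𝓡 4) ((⊤ : ℕ∞) : WithTop ℕ∞) j →
          ∀ i : Fin n, ∃ (e : EuclideanSpace ℝ (Fin 4) → X) (f : EuclideanSpace ℝ (Fin 2) → X),
            (L.component i).IsSliceDiscIn X e f) :
    ∀ (n : ℕ) (L : FramedLink (Fin n)) (Y : Type) [TopologicalSpace Y] [T2Space Y]
      [SecondCountableTopology Y] [ChartedSpace (EuclideanSpace ℝ (Fin 3)) Y]
      [IsManifold (𝓡 3) ((⊤ : ℕ∞) : WithTop ℕ∞) Y] [CompactSpace Y] [ConnectedSpace Y],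
      IsSphereTwoProdCircleSum n Y → L.IsSurgery (𝓡 3) Y →
        ∀ i : Fin n, (L.component i).IsHomotopyBallSlice := by
  intro n L Y _ _ _ _ _ _ _ hY hL i
  -- stub 1a: framed tubes with disjoint ranges; stub 1b: their radial attaching maps
  obtain ⟨ν, hfr, hνdisj⟩ := hT n L
  choose g hg using fun i => hA (L.component i) (ν i)
  have hbd := boundaryValues_of_radial (L := L) hg
  have hgdisj := pairwise_disjoint_range_of_radial (L := L) hνdisj hg
  -- attach the handles: a compact trace `P` of `L` (Kosinski VI §6, discharged)
  obtain ⟨P, _, _, _, hP2, hPσ, hPc, hP⟩ :=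
    HandleAttachingMap.exists_isMultiAttachment_holds 3 2
      (Metric.closedBall (0 : EuclideanSpace ℝ (Fin 4)) 1) (Fin n) g hgdisj
  haveI : T2Space P := hP2
  haveI : SecondCountableTopology P := hPσ
  haveI : CompactSpace P := hPc inferInstance
  have hPt : L.IsTrace P := isTrace_of_isMultiAttachment hfr hbd hP
  -- its canonical boundary datum `∂P`
  let bP : BoundaryData (𝓡∂ 4) P (𝓡 3) := BoundaryManifold.boundaryData 3 P
  haveI : T2Space bP.carrier := bP.t2Space_carrier
  haveI : SecondCountableTopology bP.carrier := bP.secondCountableTopology_carrier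
  -- stub 2: `∂P` is a surgery on `L`; uniqueness of surgery: `Y ≅ ∂P`, so `∂P ≅ #ⁿ(S² × S¹)`
  have hbP : L.IsSurgery (𝓡 3) bP.carrier := hB n L g ν hfr hνdisj hbd P hP bP
  obtain ⟨ψ⟩ := FramedLink.IsSurgery.nonempty_diffeomorph_holds hL hbP
  have hsum : IsSphereTwoProdCircleSum n bP.carrier := hY.of_diffeomorph ψ
  -- stub 3: `V ≅ ♮ⁿ S¹ × B³` with `∂V ≅ #ⁿ(S² × S¹) ≅ ∂P`
  obtain ⟨V, _, _, _, _, _, _, _, bV, hVh, hVo, hbV⟩ := hV n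
  haveI : T2Space bV.carrier := bV.t2Space_carrier
  obtain ⟨φ⟩ := IsSphereTwoProdCircleSum.nonempty_diffeomorph n bP.carrier bV.carrier hsum hbV
  -- glue `X = P ∪_φ V`: an R-link sphere, compact and `≃ₕ S⁴`
  obtain ⟨X, _, _, _, _, _, _, hX⟩ := exists_isBoundaryGluing_holds (n := 3) bP bV φ
  have hR : IsRLinkSphere X L := IsRLinkSphere.mk hPt hVh hVo hX
  haveI : CompactSpace X := hR.compactSpace
  -- stub 4: the core of the `i`-th handle, read in `X` through the gluing embedding `jP`
  obtain ⟨jP, jV, hjP, -, -, -⟩ := hX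
  obtain ⟨e, f, hef⟩ := hC n L g ν hg P hP X jP hjP i
  exact hef.isHomotopyBallSlice (IsRLinkSphere.nonempty_homotopyEquiv_sphere_holds n L X hR)

/-- **The crux modulo Kirby's sentence** (registered helper stub `helper_crux_of_kirbySentence`).  Granted the named fact
`exists_oneHandlebody_four_boundary_isSphereTwoProdCircleSum` (`OneHandlebodyBoundarySum.lean`:
for every `n` some compact connected orientable `(1,n)`-handlebody has some boundary datum which is
`#ⁿ(S² × S¹)` — Kirby 1989, Ch. I §2, p. 8; the registered stub `stub_oneHandlebody_boundary` is
this statement verbatim), the crux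
`Summit.SmoothPoincare4.SmoothPoincare4.Theses.VerlindeRLinks.VrlComponentsHBallSlice` follows from
the four LANDED stubs through the sorry-free composition above.
[GompfScharlemannThompson2010, Prop. 2.3] [Kirby1989, Ch. I §2 (p. 8)] -/
theorem helper_crux_of_kirbySentence :
    Literature.Topology.FourManifolds.exists_oneHandlebody_four_boundary_isSphereTwoProdCircleSum →
      Summit.SmoothPoincare4.SmoothPoincare4.Theses.VerlindeRLinks.VrlComponentsHBallSlice :=
  fun hK => isHomotopyBallSlice_of_stubs stub_exists_disjoint_framedTubes stub_attachingMap_of_tube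
    stub_isSurgery_boundary_of_isMultiAttachment hK stub_core_isSliceDiscIn_of_isMultiAttachment

/-- **The crux modulo the one-handle step** (registered helper stub `helper_crux_of_step`).  Granted the named fact
`isConnectedSum_boundary_of_isHandleAttachment_one` (`OneHandlebodyBoundarySum.lean` §3: attaching
one `1`-handle to a compact connected `4`-manifold with connected boundary changes the boundary by
`· # (S² × S¹)`; Kosinski VI §9, (6.6), (3.1)), Kirby's sentence holds
(`exists_oneHandlebody_four_boundary_isSphereTwoProdCircleSum_of_step`, PROVED there along the
UNIQ₄ induction vehicle), hence the crux. [Kosinski1993, VI §9] [Kirby1989, Ch. I §2 (p. 8)] -/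
theorem helper_crux_of_step :
    Literature.Topology.FourManifolds.isConnectedSum_boundary_of_isHandleAttachment_one →
      Summit.SmoothPoincare4.SmoothPoincare4.Theses.VerlindeRLinks.VrlComponentsHBallSlice :=
  fun H => helper_crux_of_kirbySentence
    (exists_oneHandlebody_four_boundary_isSphereTwoProdCircleSum_of_step H)

/-- **The crux modulo the `S⁰`-surgery lemma** (piece (2) of the roadmap of
`OneHandlebodyBoundarySum.lean`: `0`-surgery along a framed `S⁰` in a connected smooth `3`-manifold with
orientable result is a connected sum with `S² × S¹`; Kosinski VI §9 with (6.6), (3.1)): the one-handle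
step follows from it (`isConnectedSum_boundary_of_isHandleAttachment_one_of_zeroSphereSurgery`, PROVED
from the landed piece (1) `IsHandleAttachment.exists_framedSphereFamily_isSurgery_boundary`), hence the
crux. [Kosinski1993, VI §9] [Kirby1989, Ch. I §2 (p. 8)] -/
theorem helper_crux_of_zeroSphereSurgery :
    (∀ (Z : Type) [TopologicalSpace Z] [T2Space Z] [ConnectedSpace Z]
      [ChartedSpace (EuclideanSpace ℝ (Fin 3)) Z] [IsManifold (𝓡 3) ((⊤ : ℕ∞) : WithTop ℕ∞) Z]
      (νS : Literature.Topology.FourManifolds.FramedSphereFamily (𝓡 3) Z Unit 0 3)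
      (Z₂ : Type) [TopologicalSpace Z₂] [T2Space Z₂] [ChartedSpace (EuclideanSpace ℝ (Fin 3)) Z₂]
      [IsManifold (𝓡 3) ((⊤ : ℕ∞) : WithTop ℕ∞) Z₂],
      νS.IsSurgery (𝓡 3) Z₂ → Literature.Topology.FourManifolds.IsOrientable (𝓡 3) Z₂ →
        Literature.Topology.FourManifolds.IsConnectedSum (𝓡 3) (𝓡 3) ((𝓡 2).prod (𝓡 1)) Z
          ((Metric.sphere (0 : EuclideanSpace ℝ (Fin 3)) 1) × (Metric.sphere (0 : EuclideanSpace ℝ (Fin 2)) 1)) Z₂) →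
      Summit.SmoothPoincare4.SmoothPoincare4.Theses.VerlindeRLinks.VrlComponentsHBallSlice :=
  fun H2 => helper_crux_of_kirbySentence
    (exists_oneHandlebody_four_boundary_isSphereTwoProdCircleSum_of_zeroSphereSurgery H2)

end Summit.SmoothPoincare4.SmoothPoincare4.Theorems.VrlComponentsHBallSlice.KirbyLemma21

end
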